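import Mathlib
import Summits.Ventures.PercRepro.PuncturedLYMMixT4Q2Table1
import Summits.Ventures.PercRepro.PuncturedLYMMixT4Q2Table2

/-!
# PercRepro — (SP) FOR `4` PAIRWISE DISJOINT TRIPLES AND `2` PAIRWISE DISJOINT QUADRUPLES AT LEVEL `4`: POSITIVITY OF THE DENOMINATORS (1)
(p10, gen 41)

`den > 0`, `Pc > 0` for `n ≥ 20`; `Yc > 0` for `n ≥ 5`.  Nothing here asserts (SP).
-/

namespace PercRepro.PuncturedLYM.Split.TypeLift.MixT4Q2

/-- `den > 0` for `n ≥ 20`. -/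
theorem den_pos (n : ℚ) (hn : 20 ≤ n) : 0 < den n := by
  obtain ⟨n', hn', rfl⟩ : ∃ n', 0 ≤ n' ∧ n = 20 + n' := ⟨n - 20, by linarith, by ring⟩
  have h : den (20 + n') = 746496 * n' ^ 20 + 271848960 * n' ^ 19 + 47010217536 * n' ^ 18 + 5132696979456 * n' ^ 17 + 396815189774688 * n' ^ 16 + 23090547772569024 * n' ^ 15 + 1049308525187126820 * n' ^ 14 + 38131687596565609992 * n' ^ 13 + 1125400517503332099036 * n' ^ 12 + 27240784153993872785904 * n' ^ 11 + 543730090577250807218316 * n' ^ 10 + 8965004092794870537968520 * n' ^ 9 + 121885442500421393081652516 * n' ^ 8 + 1358971974521259240815910720 * n' ^ 7 + 12304282029637350921699966960 * n' ^ 6 + 89073335086590024055587909504 * n' ^ 5 + 503473838090174645190064479168 * n' ^ 4 + 2141445675512892366483696689664 * n' ^ 3 + 6447734007832818434857278630144 * n' ^ 2 + 12253480425940930461477068138496 * n' + 11054080677127314544455331123200 := by unfold den; ring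
  rw [h]; positivity

/-- `Yc > 0` for `n ≥ 5`. -/
theorem Yc_pos (n : ℚ) (hn : 5 ≤ n) : 0 < Yc n := by
  obtain ⟨n', hn', rfl⟩ : ∃ n', 0 ≤ n' ∧ n = 5 + n' := ⟨n - 5, by linarith, by ring⟩
  have h : Yc (5 + n') = (1 / 120) * n' ^ 5 + (1 / 8) * n' ^ 4 + (17 / 24) * n' ^ 3 + (15 / 8) * n' ^ 2 + (137 / 60) * n' + 1 := by unfold Yc; ring
  rw [h]; positivity

/-- `Pc > 0` for `n ≥ 20`. -/
theorem Pc_pos (n : ℚ) (hn : 20 ≤ n) : 0 < Pc n := by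
  obtain ⟨n', hn', rfl⟩ : ∃ n', 0 ≤ n' ∧ n = 20 + n' := ⟨n - 20, by linarith, by ring⟩
  have h : Pc (20 + n') = (1 / 24) * n' ^ 4 + (37 / 12) * n' ^ 3 + (2051 / 24) * n' ^ 2 + (12569 / 12) * n' + 4775 := by unfold Pc; ring
  rw [h]; positivity

end PercRepro.PuncturedLYM.Split.TypeLift.MixT4Q2
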